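import Summits.QuantumFields.YangMills.Theorems.IR.VacuumEscapeGapOfPhysicalTimeTorus
import Summits.QuantumFields.YangMills.Theorems.IR.VacuumEscapeDefs
import HarnessLib

/-!
# Line `vacuum_escape` (crux `BalabanLadder.IR`, stmt-QuantumFields-19354) — physical-time currency, part 3c:
# `PhysicalTimeConductance ⇒ SliceGapInUnits`

The currency `PhysicalTimeConductance` of `Theorems/IR/VacuumEscapeDefs.lean` (escape from every measurable slice event within PHYSICAL Euclidean time
`τ`, `n(β) = ⌈τ/a(β)⌉` steps, dominates `k₀·mass·(1 − mass)`, volume-uniformly) implies the GAP FACE `SliceGapInUnits`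
(`sliceGapInUnits_of_physicalTimeConductance`; census row B6 «EQUIV, priced», the isoperimetric direction; part 4 proves the converse): by part 3b
with `n = ⌈τ/aβ⌉`, and in units `n·aβ ≤ τ + aβ ≤ τ + 1` once `aβ ≤ 1`, so the rate `k₀²/(8n)` is `≥ (k₀²/(8(τ+1)))·aβ`.

HONEST FRAMING: a format equivalence between two typed currencies of ONE line of an open crux of a CONDITIONAL chain; the content of the line
(the LOAD `stub_noStickySliceEvent`, weak-coupling volume-uniform isoperimetry) is untouched; nothing here proves `BalabanLadder.IR`, a lattice
gap, or the Yang–Mills mass gap (Clay); R4 of the ladder closes only `BalabanLadder.UV`.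
-/

set_option autoImplicit false

noncomputable section

open MeasureTheory Filter Set Function
open scoped Topology
open Literature.MathematicalPhysics.QuantumFieldTheory

namespace Summit.QuantumFields.YangMills.Cruxes.IR.VacuumEscape


/-- **`PhysicalTimeConductance ⇒ SliceGapInUnits`** (the Cheeger direction of census row B6 of line `vacuum_escape`): for every compact `G` with a
lattice representation `r` and unit map `a > 0` with `a → 0`, physical-time conductance `k₀` at physical time `τ` gives the gap face at rate
`c₁ = k₀²/(8(τ+1))` (thresholds `β ≥ max(β₂, β₇, 0)` with `aβ ≤ 1` beyond `β₇`; `S₁` unchanged). -/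
theorem sliceGapInUnits_of_physicalTimeConductance
    {G : Type} [Group G] [TopologicalSpace G] [IsTopologicalGroup G] [CompactSpace G] [MeasurableSpace G] [BorelSpace G]
    (r : LatticeRep G) (a : ℝ → ℝ) (ha : ∀ β, 0 < a β) (ha0 : Tendsto a atTop (𝓝 0)) :
    PhysicalTimeConductance G r a → SliceGapInUnits G r a := by
  rintro ⟨k₀, τ, β₂, S₁, hk₀, hτ, hcond⟩
  haveI : SecondCountableTopology G :=
    (r.continuous.isClosedEmbedding r.injective).isEmbedding.secondCountableTopology
  -- eventually `a β ≤ 1`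
  obtain ⟨β₇, hβ₇⟩ : ∃ β₇ : ℝ, ∀ β : ℝ, β₇ ≤ β → a β ≤ 1 := by
    have hev : ∀ᶠ β in atTop, a β < 1 := ha0.eventually (gt_mem_nhds one_pos)
    obtain ⟨β₇, hh⟩ := Filter.eventually_atTop.1 hev
    exact ⟨β₇, fun β hβ => (hh β hβ).le⟩
  refine ⟨k₀ ^ 2 / (8 * (τ + 1)), max (max β₂ β₇) 0, S₁, by positivity, fun β hβ S hS => ?_⟩
  have hβ₂ : β₂ ≤ β := le_trans (le_trans (le_max_left _ _) (le_max_left _ _)) hβ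
  have hβ7 : β₇ ≤ β := le_trans (le_trans (le_max_right _ _) (le_max_left _ _)) hβ
  have hβ0 : 0 ≤ β := le_trans (le_max_right _ _) hβ
  have haβ := ha β
  have ha1 := hβ₇ β hβ7
  -- the lag `n = ⌈τ / a β⌉₊ = rlag + 1`
  set nlag : ℕ := ⌈τ / a β⌉₊ with hnlag
  have hn1 : 1 ≤ nlag := Nat.one_le_iff_ne_zero.2 (Nat.pos_iff_ne_zero.1 (Nat.ceil_pos.2 (div_pos hτ haβ)))
  obtain ⟨rlag, hrlag⟩ : ∃ rlag : ℕ, nlag = rlag + 1 := ⟨nlag - 1, by omega⟩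
  have hcond' : ∀ A : Set (GaugeConfig 3 (2 * S + 1) G), MeasurableSet A → ∃ m₀ : ℕ, ∀ m : ℕ, m₀ ≤ m →
      k₀ * (sliceMass r.ρ β (2 * S + 1) (m + 2) A * (1 - sliceMass r.ρ β (2 * S + 1) (m + 2) A)) ≤
        sliceMass r.ρ β (2 * S + 1) (m + 2) A - sliceStayN r.ρ β (2 * S + 1) (m + 2) (rlag + 1) A := by
    intro A hA
    obtain ⟨m₀, hm₀⟩ := hcond β hβ₂ S hS A hA
    refine ⟨m₀, fun m hm => ?_⟩
    have := hm₀ m hm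
    rw [← hnlag, hrlag] at this
    exact this
  obtain ⟨Kc, hKc⟩ := traceExcess_le_of_lagConductance r.continuous r.mem_unitary hβ0 S hk₀.le rlag hcond'
  -- rate comparison: `k₀²/(8 n) ≥ (k₀²/(8(τ+1))) · aβ` since `n · aβ ≤ τ + aβ ≤ τ + 1`
  have hnle : ((rlag : ℝ) + 1) * a β ≤ τ + 1 := by
    have h1 : (nlag : ℝ) < τ / a β + 1 := Nat.ceil_lt_add_one (div_pos hτ haβ).le
    have h2 : ((rlag : ℝ) + 1) = (nlag : ℝ) := by rw [hrlag]; push_cast; ring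
    rw [h2]
    have h3 : (nlag : ℝ) * a β ≤ (τ / a β + 1) * a β := mul_le_mul_of_nonneg_right h1.le haβ.le
    have h4 : (τ / a β + 1) * a β = τ + a β := by field_simp
    linarith
  have hrate : k₀ ^ 2 / (8 * (τ + 1)) * a β ≤ k₀ ^ 2 / (8 * ((rlag : ℝ) + 1)) := by
    rw [div_mul_eq_mul_div, div_le_div_iff₀ (by positivity) (by positivity)]
    have hk2 : 0 ≤ k₀ ^ 2 := sq_nonneg _
    nlinarith [mul_le_mul_of_nonneg_left hnle (by positivity : (0 : ℝ) ≤ 8 * k₀ ^ 2)]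
  refine ⟨max Kc 0, fun t ht => ?_⟩
  obtain ⟨m, rfl⟩ : ∃ m, t = m + 2 := ⟨t - 2, by omega⟩
  have h1 := hKc m
  have hm0 : (0 : ℝ) ≤ ((m + 2 : ℕ) : ℝ) := Nat.cast_nonneg _
  calc traceExcess r.ρ β (2 * S + 1) (m + 2)
      ≤ Kc * Real.exp (-(k₀ ^ 2 / (8 * ((rlag : ℝ) + 1)) * ((m + 2 : ℕ) : ℝ))) := h1
    _ ≤ max Kc 0 * Real.exp (-(k₀ ^ 2 / (8 * ((rlag : ℝ) + 1)) * ((m + 2 : ℕ) : ℝ))) :=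
        mul_le_mul_of_nonneg_right (le_max_left _ _) (Real.exp_nonneg _)
    _ ≤ max Kc 0 * Real.exp (-(k₀ ^ 2 / (8 * (τ + 1)) * a β * ((m + 2 : ℕ) : ℝ))) := by
        refine mul_le_mul_of_nonneg_left (Real.exp_le_exp.2 (neg_le_neg ?_)) (le_max_right _ _)
        exact mul_le_mul_of_nonneg_right hrate hm0


end Summit.QuantumFields.YangMills.Cruxes.IR.VacuumEscape

end
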